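import Mathlib
import Literature.AlgebraicGeometry.Tropical.InitialIdeal
import Literature.AlgebraicGeometry.Tropical.SchonIdeal
import Literature.AlgebraicGeometry.Tropical.TropicalLink
import Summits.ResolutionOfSingularities.ResolutionOfSingularities.Theorems.TropicalLinksInductiveStepWeightZero
import Summits.ResolutionOfSingularities.ResolutionOfSingularities.Theorems.TropicalLinksInductiveStepDomCongr
import Summits.ResolutionOfSingularities.ResolutionOfSingularities.Theorems.TropicalLinksInductiveStepRayDegeneration
import Summits.ResolutionOfSingularities.ResolutionOfSingularities.Theorems.TropicalLinksInductiveStepWeightScaling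
import Summits.ResolutionOfSingularities.ResolutionOfSingularities.Theorems.TropicalLinksInductiveStepWeightSplitting
import Summits.ResolutionOfSingularities.ResolutionOfSingularities.Theorems.TropicalLinksInductiveStepLaurentRegular

/-!
# TropicalLinks / InductiveStep — schön ⟺ regular with regular ray fibres (Gröbner dictionary,
# capstone brick B8)

Route `ResolutionOfSingularities/TropicalLinks`, crux `InductiveStep` (stmt-ResolutionOfSingularities-17233),
line `split`, in support of stub `stub_sncClosureSchon` (Luxton–Qu: an snc compactification with
unimodular boundary makes the principal open schön).  The schön clause of the route — `IsSchonIdeal I`,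
all initial degenerations `k[ℤ^n] ⧸ in_w(I)`, `w ∈ ℤ^n`, regular at every prime — is here turned into
a statement WITHOUT Gröbner theory:

* `tropicalLinks_forall_prime_regular_initialIdeal_fst_comp_iff` — for a lattice splitting
  `e : ℤ^n ≃+ ℤ × K`, the degeneration `k[ℤ^n] ⧸ in_{fst ∘ e}(I)` is regular at all primes iff the
  FIBRE RING `k[K] ⧸ 𝔣_e` is, where `𝔣_e` is the ideal of the scheme-theoretic fibre `{x₁ = 0}` of
  the closure of `e · V(I)` in the partial compactification `𝔸¹ × T_K ⊇ 𝔾_m × T_K` (assembled from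
  B1 `tropicalLinks_initialIdeal_map_domCongr`, B4 `tropicalLinks_nonempty_quotient_initialIdeal_fst_algEquiv`,
  B7 `tropicalLinks_forall_prime_regular_laurent_iff`);
* `tropicalLinks_isSchonIdeal_iff_forall_rayFibre` (registered brick B8) — **`V(I) ⊆ 𝔾_m^n` is schön
  iff `V(I)` is regular and, for every lattice splitting `e : ℤ^n ≃+ ℤ × K`, the special fibre of the
  closure of `e · V(I)` in `𝔸¹ × T_K` is regular** (`w = 0` gives the first conjunct; a nonzero
  weight is `ℓ · (fst ∘ e)` for a splitting `e` and `ℓ > 0` by B6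
  `tropicalLinks_exists_addEquiv_fst_eq_dotWeight`, and `in_{ℓ w} = in_w` by B5).

This is the standard dictionary "initial degeneration along a ray = 𝔾_m × flat limit" (Maclagan–
Sturmfels, *Introduction to Tropical Geometry*, §2.4–3.x; Helm–Katz 2012 §3) in the form needed to
attack `stub_sncClosureSchon` geometrically: what remains is to show that for the Luxton–Qu open
`U° = X̄ ∖ D` (snc, unimodular unit lattice) these fibres are `𝔾_m^{r-1} ×` (open boundary strata).
No new definitions.
-/

-- single-problem summit: the doubled namespace component `ResolutionOfSingularities` is forced
set_option linter.dupNamespace false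

namespace Summit.ResolutionOfSingularities.ResolutionOfSingularities.Theorems

open AddMonoidAlgebra Literature.AlgebraicGeometry.Tropical

/-- An additive functional on `ℤ^n` is the weight pairing with the vector of its values on the
standard basis. [folklore] -/
theorem tropicalLinks_coe_addMonoidHom_eq_dotWeight {n : ℕ} (φ : (Fin n → ℤ) →+ ℤ) :
    (φ : (Fin n → ℤ) → ℤ) = dotWeight fun i => φ (Pi.single i 1) := by
  have h : φ = dotWeightHom fun i => φ (Pi.single i 1) := by
    refine AddMonoidHom.functions_ext' ℤ _ _ fun i => AddMonoidHom.ext_int ?_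
    simp [tropicalLinks_dotWeight_single]
  exact congrArg (fun ψ : (Fin n → ℤ) →+ ℤ => (ψ : (Fin n → ℤ) → ℤ)) h

/-- The Laurent polynomial ring `k[ℤ^n]` over a field is Noetherian. [folklore] -/
theorem tropicalLinks_isNoetherianRing_laurent (k : Type) [Field k] (n : ℕ) :
    IsNoetherianRing (AddMonoidAlgebra k (Fin n → ℤ)) :=
  Algebra.FiniteType.isNoetherianRing k _

/-- **The degeneration along the first coordinate of a lattice splitting is regular iff the special
fibre is** (dictionary, assembled): for `e : ℤ^n ≃+ ℤ × K` and an ideal `I ⊆ k[ℤ^n]`, all prime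
localizations of `k[ℤ^n] ⧸ in_{fst ∘ e}(I)` are regular iff all prime localizations of the fibre ring
`k[K] ⧸ 𝔣` are, where `𝔣` is the fibre ideal of `e·I` (bricks B1, B4, B7). [folklore] -/
theorem tropicalLinks_forall_prime_regular_initialIdeal_fst_comp_iff {k : Type} [Field k] {n : ℕ}
    (I : Ideal (AddMonoidAlgebra k (Fin n → ℤ))) (K : Type) [AddCommGroup K]
    (e : (Fin n → ℤ) ≃+ ℤ × K) :
    (∀ (P : Ideal (AddMonoidAlgebra k (Fin n → ℤ) ⧸
        initialIdeal ((AddMonoidHom.fst ℤ K : ℤ × K → ℤ) ∘ e) I)) [P.IsPrime],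
        IsRegularLocalRing (Localization.AtPrime P)) ↔
      ∀ (P : Ideal (AddMonoidAlgebra k K ⧸ linkIdeal (AddMonoidHom.inr ℕ K)
        (linkIdeal ((Nat.castAddMonoidHom ℤ).prodMap (AddMonoidHom.id K)) (I.map (domCongr k k e)) ⊔
          Ideal.span {single ((1 : ℕ), (0 : K)) (1 : k)}))) [P.IsPrime],
        IsRegularLocalRing (Localization.AtPrime P) := by
  set J : Ideal (AddMonoidAlgebra k (ℤ × K)) := I.map (domCongr k k e) with hJ_def
  -- `in_fst(J) = k[e](in_{fst ∘ e}(I))`, so the two degenerations have isomorphic coordinate rings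
  have hin : initialIdeal (AddMonoidHom.fst ℤ K) J =
      (initialIdeal ((AddMonoidHom.fst ℤ K : ℤ × K → ℤ) ∘ e) I).map (domCongr k k e) :=
    tropicalLinks_initialIdeal_map_domCongr e _ I
  have iso1 : (AddMonoidAlgebra k (Fin n → ℤ) ⧸ initialIdeal ((AddMonoidHom.fst ℤ K : ℤ × K → ℤ) ∘ e) I)
      ≃ₐ[k] (AddMonoidAlgebra k (ℤ × K) ⧸ initialIdeal (AddMonoidHom.fst ℤ K) J) :=
    Ideal.quotientEquivAlg _ _ (domCongr k k e) hin
  obtain ⟨iso2⟩ := tropicalLinks_nonempty_quotient_initialIdeal_fst_algEquiv k K J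
  have iso := iso1.trans iso2
  -- Noetherianity of the Laurent ring over the fibre ring, through the isomorphism
  haveI : IsNoetherianRing (AddMonoidAlgebra k (Fin n → ℤ)) := tropicalLinks_isNoetherianRing_laurent k n
  have hN : IsNoetherianRing (AddMonoidAlgebra (AddMonoidAlgebra k K ⧸ linkIdeal (AddMonoidHom.inr ℕ K)
      (linkIdeal ((Nat.castAddMonoidHom ℤ).prodMap (AddMonoidHom.id K)) J ⊔
        Ideal.span {single ((1 : ℕ), (0 : K)) (1 : k)})) ℤ) :=
    isNoetherianRing_of_ringEquiv _ iso.toRingEquiv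
  rw [← tropicalLinks_forall_prime_regular_laurent_iff _ hN]
  constructor
  · intro h
    exact tropicalLinks_forall_prime_regular_of_ringEquiv iso.toRingEquiv h
  · intro h
    exact tropicalLinks_forall_prime_regular_of_ringEquiv iso.symm.toRingEquiv h

/-- **Schön ⟺ regular with regular ray fibres** (registered brick B8, the capstone of the
dictionary).  For an ideal `I ⊆ k[ℤ^n]` over a field: `IsSchonIdeal I` (every initial degeneration
`k[ℤ^n] ⧸ in_w(I)`, `w ∈ ℤ^n`, regular at all primes) iff (i) `k[ℤ^n] ⧸ I` is regular at all primes
and (ii) for every lattice splitting `e : ℤ^n ≃+ ℤ × K`, the fibre ring `k[K] ⧸ 𝔣_e` of the special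
fibre `{x₁ = 0}` of the closure of `e · V(I)` in `𝔸¹ × T_K` is regular at all primes. [folklore] -/
theorem tropicalLinks_isSchonIdeal_iff_forall_rayFibre :
    ∀ (k : Type) [Field k] (n : ℕ) (I : Ideal (AddMonoidAlgebra k (Fin n → ℤ))), Literature.AlgebraicGeometry.Tropical.IsSchonIdeal I ↔ ((∀ (P : Ideal (AddMonoidAlgebra k (Fin n → ℤ) ⧸ I)) [P.IsPrime], IsRegularLocalRing (Localization.AtPrime P)) ∧ ∀ (K : Type) [AddCommGroup K] (e : (Fin n → ℤ) ≃+ ℤ × K) (P : Ideal (AddMonoidAlgebra k K ⧸ Literature.AlgebraicGeometry.Tropical.linkIdeal (AddMonoidHom.inr ℕ K) (Literature.AlgebraicGeometry.Tropical.linkIdeal ((Nat.castAddMonoidHom ℤ).prodMap (AddMonoidHom.id K)) (I.map (AddMonoidAlgebra.domCongr k k e)) ⊔ Ideal.span {AddMonoidAlgebra.single ((1 : ℕ), (0 : K)) (1 : k)}))) [P.IsPrime], IsRegularLocalRing (Localization.AtPrime P)) := by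
  intro k _ n I
  constructor
  · intro h
    refine ⟨fun P _ => h.isRegularLocalRing_localization_quotient P, fun K _ e => ?_⟩
    rw [← tropicalLinks_forall_prime_regular_initialIdeal_fst_comp_iff I K e]
    -- the weight `wᵢ = (e eᵢ).1` has `⟨w, ·⟩ = fst ∘ e`
    have hw : ((AddMonoidHom.fst ℤ K : ℤ × K → ℤ) ∘ e) =
        dotWeight fun i => ((AddMonoidHom.fst ℤ K).comp e.toAddMonoidHom) (Pi.single i 1) :=
      tropicalLinks_coe_addMonoidHom_eq_dotWeight ((AddMonoidHom.fst ℤ K).comp e.toAddMonoidHom)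
    rw [hw]
    exact h _
  · rintro ⟨h0, hray⟩ w
    by_cases hw : w = 0
    · subst hw
      exact (tropicalLinks_forall_prime_regular_congr (weightInitialIdeal_zero I)).2 h0
    obtain ⟨ℓ, K, _, e, hℓ, he⟩ := tropicalLinks_exists_addEquiv_fst_eq_dotWeight n w hw
    have hwe : dotWeight w = (fun x : ℤ => ℓ * x) ∘ ((AddMonoidHom.fst ℤ K : ℤ × K → ℤ) ∘ e) :=
      funext fun v => (he v).symm
    have hin : weightInitialIdeal w I = initialIdeal ((AddMonoidHom.fst ℤ K : ℤ × K → ℤ) ∘ e) I := by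
      rw [weightInitialIdeal, hwe]
      exact tropicalLinks_initialIdeal_comp_strictMono _ (fun a b hab => by
        show ℓ * a < ℓ * b
        exact Int.mul_lt_mul_of_pos_left hab hℓ) I
    exact (tropicalLinks_forall_prime_regular_congr hin).2
      ((tropicalLinks_forall_prime_regular_initialIdeal_fst_comp_iff I K e).2 (hray K e))

end Summit.ResolutionOfSingularities.ResolutionOfSingularities.Theorems
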